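import Literature.NumberTheory.ModularForms.BinaryThetaWeighted
import Mathlib.Analysis.Complex.UpperHalfPlane.MoebiusAction
import HarnessLib

/-!
# Coset theta series of weight two: the law on `Γ₀(D·M)` (toward K0⁺, stmt-20690)

Route `ResidualThetaTransportAtTwo`, crux K0⁺ `HeckeThetaPartnerAdicAtTwo` (stmt-BirchSwinnertonDyer-20690),
line "Hecke theta series from the genus-two Riemann theta function".  THEOREMS ONLY.

Matrix level.  For an even symmetric positive definite `B ∈ M₂(ℤ)` with `det B = D`, a level
`M ≥ 1` and `k ∈ ℤ²`, the **coset gradient theta** is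
`τ ↦ ∇_v ϑ[k/M; 0](0, (Mτ)·B)` (the theta series of the coset `k/M + ℤ²` of the form `½M·B`
with a linear form inserted).  For `γ = (a b; c d) ∈ SL₂(ℤ)` with `D·M ∣ c` let
`γ' = (a, bM; c/M, d)` (`exists_levelLift`), so that `M·γτ = γ'(Mτ)`; the genus-two law
(`BinaryThetaWeighted.fderiv_riemannThetaChar_symplEmbed_smul` for `γ'` at `τ' = Mτ`) reads, after
the bookkeeping of the characteristic `M̃[k/M; 0] = [d k/M + s; t]` with `s, t ∈ ℤ²`
(`thetaCharFst_symplEmbed_div`, `thetaCharSnd_symplEmbed_div`) and of the phase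
(`thetaTransformPhase_symplEmbed_div`):

  `∇ϑ[d k/M; 0](0, (M γτ)·B) = λ (cτ+d)² e(πi b d ᵗkBk/M) · ∇ϑ[k/M; 0](0, (Mτ)·B)`

(`fderiv_thetaCoset_smul`), `λ` the unit of `BinaryThetaNull` for `γ'`.

BSD is not proved by this file.
-/

set_option autoImplicit false
set_option linter.dupNamespace false

noncomputable section

open scoped Real MatrixGroups UpperHalfPlane
open Matrix Complex Filter

namespace Summit.BirchSwinnertonDyer.BirchSwinnertonDyer.Theorems.HeckeTheta

open Literature.Analysis.SpecialFunctions
open Literature.NumberTheory.ModularForms.BinaryTheta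
open Literature.NumberTheory.Automorphic (siegelUpperHalfSpace mem_siegelUpperHalfSpace_iff)
open Literature.NumberTheory.ModularForms.SiegelUpperHalfSpace (denom)

/-! ### The lift `γ' = (a, bM; c/M, d)` of `γ ∈ Γ₀(M)` -/

/-- For `M ∣ c`, `γ' = (a, bM; c/M, d)` is again in `SL₂(ℤ)`. -/
theorem exists_levelLift (M : ℕ) (γ : SL(2, ℤ)) (hγ : (M : ℤ) ∣ (γ 1 0 : ℤ)) :
    ∃ γ' : SL(2, ℤ), (γ' 0 0 : ℤ) = γ 0 0 ∧ (γ' 0 1 : ℤ) = (γ 0 1 : ℤ) * M ∧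
      (γ' 1 0 : ℤ) * M = γ 1 0 ∧ (γ' 1 1 : ℤ) = γ 1 1 := by
  obtain ⟨c', hc'⟩ := hγ
  have hdet := Matrix.SpecialLinearGroup.det_coe γ
  rw [Matrix.det_fin_two, hc'] at hdet
  refine ⟨⟨!![(γ 0 0 : ℤ), (γ 0 1 : ℤ) * M; c', (γ 1 1 : ℤ)], ?_⟩, rfl, rfl, ?_, rfl⟩
  · rw [Matrix.det_fin_two_of]; linear_combination hdet
  · show c' * (M : ℤ) = γ 1 0
    rw [hc', mul_comm]

/-- The automorphy factor of the lift: `(c/M)(Mτ) + d = cτ + d`. -/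
theorem levelLift_denom {M : ℕ} {γ γ' : SL(2, ℤ)} (h10 : (γ' 1 0 : ℤ) * M = γ 1 0)
    (h11 : (γ' 1 1 : ℤ) = γ 1 1) (τ : ℂ) :
    ((γ' 1 0 : ℤ) : ℂ) * ((M : ℂ) * τ) + ((γ' 1 1 : ℤ) : ℂ) =
      ((γ 1 0 : ℤ) : ℂ) * τ + ((γ 1 1 : ℤ) : ℂ) := by
  have hc : ((γ' 1 0 : ℤ) : ℂ) * (M : ℂ) = ((γ 1 0 : ℤ) : ℂ) := by exact_mod_cast h10
  rw [← mul_assoc, hc, h11]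

/-- `γ'(Mτ) = M·(γτ)` for the lift `γ'` of `γ`. -/
theorem levelLift_moeb {M : ℕ} (hM : 0 < M) {γ γ' : SL(2, ℤ)} (h00 : (γ' 0 0 : ℤ) = γ 0 0)
    (h01 : (γ' 0 1 : ℤ) = (γ 0 1 : ℤ) * M) (h10 : (γ' 1 0 : ℤ) * M = γ 1 0) (h11 : (γ' 1 1 : ℤ) = γ 1 1)
    (τ : ℍ) :
    (((γ' 0 0 : ℤ) : ℂ) * ((M : ℂ) * (τ : ℂ)) + ((γ' 0 1 : ℤ) : ℂ)) /
        (((γ' 1 0 : ℤ) : ℂ) * ((M : ℂ) * (τ : ℂ)) + ((γ' 1 1 : ℤ) : ℂ)) =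
      (M : ℂ) * ((γ • τ : ℍ) : ℂ) := by
  have _ := hM
  have hden : ((γ 1 0 : ℤ) : ℂ) * (τ : ℂ) + ((γ 1 1 : ℤ) : ℂ) ≠ 0 := by
    have := UpperHalfPlane.denom_ne_zero γ τ
    rwa [ModularGroup.denom_apply] at this
  rw [levelLift_denom h10 h11, UpperHalfPlane.coe_specialLinearGroup_apply]
  simp only [eq_intCast, Complex.ofReal_intCast]
  rw [h00, h01]
  push_cast
  field_simp

/-! ### The transformed characteristic `M̃[k/M; 0]` -/

/-- `½·(x·y) = x·(y/2)` in `ℂ` for even `y ∈ ℤ`. -/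
theorem two_inv_mul_intCast_mul_even {x y : ℤ} (hy : Even y) :
    (2⁻¹ : ℂ) * ((x * y : ℤ) : ℂ) = ((x * (y / 2) : ℤ) : ℂ) := by
  obtain ⟨e, rfl⟩ := hy
  rw [show e + e = 2 * e by ring, Int.mul_ediv_cancel_left _ two_ne_zero]
  push_cast
  ring

variable {B : Matrix (Fin 2) (Fin 2) ℤ} {γ γ' : SL(2, ℤ)} {M : ℕ}

/-- **`M̃[k/M; 0]¹ = d·k/M + s`** with the INTEGER vector `s = ((c'/D) d B₁₁/2, (c'/D) d B₀₀/2)`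
(`M̃ = symplEmbed B γ'`, `B` with even diagonal). -/
theorem thetaCharFst_symplEmbed_div (h00 : Even (B 0 0)) (h11 : Even (B 1 1)) (γ' : SL(2, ℤ))
    (k : Fin 2 → ℤ) (M : ℕ) :
    thetaCharFst (symplEmbed B γ') (fun i => (k i : ℂ) / M) 0 =
      (fun i => ((γ' 1 1 : ℤ) : ℂ) * ((k i : ℂ) / M)) + fun i =>
        ((![(γ' 1 0 : ℤ) / B.det * (γ' 1 1 : ℤ) * (B 1 1 / 2),
            (γ' 1 0 : ℤ) / B.det * (γ' 1 1 : ℤ) * (B 0 0 / 2)] : Fin 2 → ℤ) i : ℂ) := by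
  rw [thetaCharFst_symplEmbed]
  funext i
  fin_cases i
  · simp only [Fin.zero_eta, Fin.isValue, Matrix.cons_val_zero, Pi.zero_apply, mul_zero, sub_zero,
      Pi.add_apply]
    rw [two_inv_mul_intCast_mul_even h11]
  · simp only [Fin.mk_one, Fin.isValue, Matrix.cons_val_one, Matrix.cons_val_zero, Pi.zero_apply,
      mul_zero, add_zero, sub_zero, Pi.add_apply]
    rw [two_inv_mul_intCast_mul_even h00]

/-- **`M̃[k/M; 0]² = t`** with the INTEGER vector
`t = (-b (B₀₀k₀ + B₀₁k₁) + a b M B₀₀/2, -b (B₁₀k₀ + B₁₁k₁) + a b M B₁₁/2)` (`γ' = (a, bM; c/M, d)`). -/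
theorem thetaCharSnd_symplEmbed_div (h00 : Even (B 0 0)) (h11 : Even (B 1 1)) (hM : 0 < M)
    (h01 : (γ' 0 1 : ℤ) = (γ 0 1 : ℤ) * M) (k : Fin 2 → ℤ) :
    thetaCharSnd (symplEmbed B γ') (fun i => (k i : ℂ) / M) 0 =
      (0 : Fin 2 → ℂ) + fun i =>
        ((![-(γ 0 1 : ℤ) * (B 0 0 * k 0 + B 0 1 * k 1) + (γ' 0 0 : ℤ) * (γ' 0 1 : ℤ) * (B 0 0 / 2),
            -(γ 0 1 : ℤ) * (B 1 0 * k 0 + B 1 1 * k 1) + (γ' 0 0 : ℤ) * (γ' 0 1 : ℤ) * (B 1 1 / 2)] :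
          Fin 2 → ℤ) i : ℂ) := by
  have hM' : (M : ℂ) ≠ 0 := by exact_mod_cast hM.ne'
  rw [thetaCharSnd_symplEmbed, zero_add]
  funext i
  fin_cases i
  · simp only [Fin.zero_eta, Fin.isValue, Matrix.cons_val_zero, Pi.zero_apply, mul_zero, zero_sub]
    rw [two_inv_mul_intCast_mul_even h00, h01]
    push_cast
    field_simp
  · simp only [Fin.mk_one, Fin.isValue, Matrix.cons_val_one, Matrix.cons_val_zero, Pi.zero_apply,
      mul_zero, zero_sub]
    rw [two_inv_mul_intCast_mul_even h11, h01]
    push_cast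
    field_simp


/-! ### The phase -/

/-- **The phase bookkeeping**: `πi k(M̃, k/M, 0) - 2πi ᵗ(d k/M) t = πi · b d ᵗkBk / M`. -/
theorem thetaTransformPhase_symplEmbed_div (hB : B.IsSymm) (h00 : Even (B 0 0)) (h11 : Even (B 1 1))
    (hM : 0 < M) (h01 : (γ' 0 1 : ℤ) = (γ 0 1 : ℤ) * M) (k : Fin 2 → ℤ) :
    π * I * thetaTransformPhase (symplEmbed B γ') (fun i => (k i : ℂ) / M) 0 -
        2 * π * I * ((fun i => ((γ' 1 1 : ℤ) : ℂ) * ((k i : ℂ) / M)) ⬝ᵥ fun i =>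
          ((![-(γ 0 1 : ℤ) * (B 0 0 * k 0 + B 0 1 * k 1) + (γ' 0 0 : ℤ) * (γ' 0 1 : ℤ) * (B 0 0 / 2),
              -(γ 0 1 : ℤ) * (B 1 0 * k 0 + B 1 1 * k 1) + (γ' 0 0 : ℤ) * (γ' 0 1 : ℤ) * (B 1 1 / 2)] :
            Fin 2 → ℤ) i : ℂ)) =
      π * I * (((γ 0 1 : ℤ) : ℂ) * ((γ' 1 1 : ℤ) : ℂ) * ((k ⬝ᵥ (B *ᵥ k) : ℤ) : ℂ) / M) := by
  have hM' : (M : ℂ) ≠ 0 := by exact_mod_cast hM.ne'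
  have he0 : ((B 0 0 / 2 : ℤ) : ℂ) * 2 = ((B 0 0 : ℤ) : ℂ) := by
    exact_mod_cast Int.ediv_mul_cancel (even_iff_two_dvd.mp h00)
  have he1 : ((B 1 1 / 2 : ℤ) : ℂ) * 2 = ((B 1 1 : ℤ) : ℂ) := by
    exact_mod_cast Int.ediv_mul_cancel (even_iff_two_dvd.mp h11)
  have h10' : ((B 1 0 : ℤ) : ℂ) = ((B 0 1 : ℤ) : ℂ) := by rw [hB.apply 0 1]
  obtain ⟨hb11, hb12, hb21, hb22⟩ := symplEmbed_map_toBlocks B γ'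
  have hphase : thetaTransformPhase (symplEmbed B γ') (fun i => (k i : ℂ) / M) 0 =
      ((γ' 1 1 : ℤ) : ℂ) * ((k 0 : ℂ) / M) *
          (-(((γ' 0 1 : ℤ) : ℂ) * (((B 0 0 : ℤ) : ℂ) * ((k 0 : ℂ) / M) + ((B 0 1 : ℤ) : ℂ) * ((k 1 : ℂ) / M))) +
            ((γ' 0 0 : ℤ) : ℂ) * (((γ' 0 1 : ℤ) : ℂ) * ((B 0 0 : ℤ) : ℂ))) +
        ((γ' 1 1 : ℤ) : ℂ) * ((k 1 : ℂ) / M) *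
          (-(((γ' 0 1 : ℤ) : ℂ) * (((B 1 0 : ℤ) : ℂ) * ((k 0 : ℂ) / M) + ((B 1 1 : ℤ) : ℂ) * ((k 1 : ℂ) / M))) +
            ((γ' 0 0 : ℤ) : ℂ) * (((γ' 0 1 : ℤ) : ℂ) * ((B 1 1 : ℤ) : ℂ))) := by
    rw [thetaTransformPhase_def, hb11, hb12, hb21, hb22]
    simp [dotProduct, Fin.sum_univ_two, symplEmbed, Matrix.toBlocks₁₁, Matrix.toBlocks₁₂,
      Matrix.mul_apply]
    ring
  rw [hphase, h01]
  simp only [dotProduct, Fin.sum_univ_two, Matrix.mulVec, Matrix.cons_val_zero, Matrix.cons_val_one]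
  push_cast
  rw [h10']
  have hu : (M : ℂ) * (M : ℂ)⁻¹ = 1 := mul_inv_cancel₀ hM'
  simp only [div_eq_mul_inv]
  linear_combination
    (-(↑π * I * ((γ' 1 1 : ℤ) : ℂ) * ((γ 0 1 : ℤ) : ℂ) * (M : ℂ)⁻¹ *
      ((k 0 : ℂ) * (((B 0 0 : ℤ) : ℂ) * (k 0 : ℂ) + ((B 0 1 : ℤ) : ℂ) * (k 1 : ℂ)) +
        (k 1 : ℂ) * (((B 0 1 : ℤ) : ℂ) * (k 0 : ℂ) + ((B 1 1 : ℤ) : ℂ) * (k 1 : ℂ))))) * hu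
    - (↑π * I * ((γ' 1 1 : ℤ) : ℂ) * ((γ' 0 0 : ℤ) : ℂ) * ((γ 0 1 : ℤ) : ℂ) * ((M : ℂ) * (M : ℂ)⁻¹) *
        (k 0 : ℂ)) * he0
    - (↑π * I * ((γ' 1 1 : ℤ) : ℂ) * ((γ' 0 0 : ℤ) : ℂ) * ((γ 0 1 : ℤ) : ℂ) * ((M : ℂ) * (M : ℂ)⁻¹) *
        (k 1 : ℂ)) * he1


/-! ### The weight-two law of the coset gradient theta -/

/-- `z ↦ ϑ[a; b](z, τ·B)` is entire for `Im τ > 0` and `B` symmetric positive definite. -/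
theorem differentiable_riemannThetaChar_smul (hB : B.IsSymm)
    (hpos : (B.map (Int.cast : ℤ → ℝ)).PosDef) {τ : ℂ} (hτ : 0 < τ.im) (a b : Fin 2 → ℂ) :
    Differentiable ℂ (riemannThetaChar a b (τ • B.map ((↑) : ℤ → ℂ))) := by
  have hZ := smul_mem_siegelUpperHalfSpace hB hpos hτ
  obtain ⟨c, hc, hY⟩ := exists_pos_mul_sum_sq_le_of_posDef_im _ hZ.2
  have hZs : ∀ i j, (τ • B.map ((↑) : ℤ → ℂ)) i j = (τ • B.map ((↑) : ℤ → ℂ)) j i :=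
    fun i j => (hZ.1.apply i j).symm
  exact differentiable_riemannThetaChar _ hZs hc hY a b

/-- `Im (Mτ) > 0` for `τ ∈ ℍ` and `M ≥ 1`. -/
theorem im_natCast_mul_pos (hM : 0 < M) (τ : ℍ) : 0 < ((M : ℂ) * (τ : ℂ)).im := by
  rw [Complex.mul_im, Complex.natCast_re, Complex.natCast_im, zero_mul, add_zero]
  exact mul_pos (by exact_mod_cast hM) τ.im_pos

/-- **The weight-two law of the coset gradient theta on `Γ₀(D·M)`.**  For `B` even symmetric
positive definite, `M ≥ 1`, `γ = (a b; c d)` with lift `γ' = (a, bM; c/M, d) ∈ SL₂(ℤ)` and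
`det B ∣ c/M`, the unit `λ` of the genus-two law for `γ'` (`BinaryThetaNull`), and `k ∈ ℤ²`:
`∇ϑ[d·k/M; 0](0, (M·γτ)·B) = λ (cτ+d)² e(πi b d ᵗkBk/M) · ∇ϑ[k/M; 0](0, (Mτ)·B)`. -/
theorem fderiv_thetaCoset_smul (hB : B.IsSymm) (h00 : Even (B 0 0)) (h11 : Even (B 1 1))
    (hpos : (B.map (Int.cast : ℤ → ℝ)).PosDef) (hM : 0 < M)
    (h00' : (γ' 0 0 : ℤ) = γ 0 0) (h01' : (γ' 0 1 : ℤ) = (γ 0 1 : ℤ) * M)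
    (h10' : (γ' 1 0 : ℤ) * M = γ 1 0) (h11' : (γ' 1 1 : ℤ) = γ 1 1) (hγ' : B.det ∣ (γ' 1 0 : ℤ))
    {Λ : ℂ} (hΛ : ∀ τ : ℂ, 0 < τ.im → ∀ (a b v : Fin 2 → ℂ),
      riemannThetaChar (thetaCharFst (symplEmbed B γ') a b) (thetaCharSnd (symplEmbed B γ') a b)
          (((((γ' 0 0 : ℤ) : ℂ) * τ + ((γ' 0 1 : ℤ) : ℂ)) / (((γ' 1 0 : ℤ) : ℂ) * τ + ((γ' 1 1 : ℤ) : ℂ))) •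
            B.map ((↑) : ℤ → ℂ))
          ((((γ' 1 0 : ℤ) : ℂ) * τ + ((γ' 1 1 : ℤ) : ℂ))⁻¹ • v) =
        Λ * (((γ' 1 0 : ℤ) : ℂ) * τ + ((γ' 1 1 : ℤ) : ℂ)) *
          cexp (π * I * thetaTransformPhase (symplEmbed B γ') a b) *
          cexp (π * I * (v ⬝ᵥ ((denom ((symplEmbed B γ').map ((↑) : ℤ → ℂ)) (τ • B.map ((↑) : ℤ → ℂ)))⁻¹ *
                ((symplEmbed B γ').map ((↑) : ℤ → ℂ)).toBlocks₂₁) *ᵥ v)) *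
            riemannThetaChar a b (τ • B.map ((↑) : ℤ → ℂ)) v)
    (k : Fin 2 → ℤ) (τ : ℍ) :
    fderiv ℂ (riemannThetaChar (fun i => ((γ 1 1 : ℤ) : ℂ) * ((k i : ℂ) / M)) 0
        (((M : ℂ) * ((γ • τ : ℍ) : ℂ)) • B.map ((↑) : ℤ → ℂ))) 0 =
      (Λ * (((γ 1 0 : ℤ) : ℂ) * (τ : ℂ) + ((γ 1 1 : ℤ) : ℂ)) ^ 2 *
          cexp (π * I * (((γ 0 1 : ℤ) : ℂ) * ((γ 1 1 : ℤ) : ℂ) * ((k ⬝ᵥ (B *ᵥ k) : ℤ) : ℂ) / M))) •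
        fderiv ℂ (riemannThetaChar (fun i => (k i : ℂ) / M) 0
          (((M : ℂ) * (τ : ℂ)) • B.map ((↑) : ℤ → ℂ))) 0 := by
  have hτ' := im_natCast_mul_pos hM τ
  have hF3 := fderiv_riemannThetaChar_symplEmbed_smul hB hpos hγ' (fun i => (k i : ℂ) / M) 0
    (fun z hz v => hΛ z hz _ 0 v) hτ'
  rw [levelLift_moeb hM h00' h01' h10' h11' τ, levelLift_denom h10' h11',
    thetaCharFst_symplEmbed_div h00 h11 γ' k M, thetaCharSnd_symplEmbed_div h00 h11 hM h01' k,
    h11'] at hF3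
  -- the Siegel point `(M·γτ)·B` and differentiability there
  have hγτ : 0 < ((M : ℂ) * ((γ • τ : ℍ) : ℂ)).im := im_natCast_mul_pos hM (γ • τ)
  set Ω' : Matrix (Fin 2) (Fin 2) ℂ := ((M : ℂ) * ((γ • τ : ℍ) : ℂ)) • B.map ((↑) : ℤ → ℂ) with hΩ'
  have hdiff := differentiable_riemannThetaChar_smul hB hpos hγτ
    (fun i => ((γ 1 1 : ℤ) : ℂ) * ((k i : ℂ) / M)) 0
  -- integral shift of the characteristic
  rw [show riemannThetaChar
        ((fun i => ((γ 1 1 : ℤ) : ℂ) * ((k i : ℂ) / M)) + fun i =>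
          ((![(γ' 1 0 : ℤ) / B.det * (γ 1 1 : ℤ) * (B 1 1 / 2),
              (γ' 1 0 : ℤ) / B.det * (γ 1 1 : ℤ) * (B 0 0 / 2)] : Fin 2 → ℤ) i : ℂ))
        ((0 : Fin 2 → ℂ) + fun i =>
          ((![-(γ 0 1 : ℤ) * (B 0 0 * k 0 + B 0 1 * k 1) + (γ' 0 0 : ℤ) * (γ' 0 1 : ℤ) * (B 0 0 / 2),
              -(γ 0 1 : ℤ) * (B 1 0 * k 0 + B 1 1 * k 1) + (γ' 0 0 : ℤ) * (γ' 0 1 : ℤ) * (B 1 1 / 2)] :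
            Fin 2 → ℤ) i : ℂ)) Ω' =
      fun z => cexp (2 * π * I * ((fun i => ((γ 1 1 : ℤ) : ℂ) * ((k i : ℂ) / M)) ⬝ᵥ fun i =>
          ((![-(γ 0 1 : ℤ) * (B 0 0 * k 0 + B 0 1 * k 1) + (γ' 0 0 : ℤ) * (γ' 0 1 : ℤ) * (B 0 0 / 2),
              -(γ 0 1 : ℤ) * (B 1 0 * k 0 + B 1 1 * k 1) + (γ' 0 0 : ℤ) * (γ' 0 1 : ℤ) * (B 1 1 / 2)] :
            Fin 2 → ℤ) i : ℂ))) *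
        riemannThetaChar (fun i => ((γ 1 1 : ℤ) : ℂ) * ((k i : ℂ) / M)) 0 Ω' z from
      funext fun z => riemannThetaChar_charShift _ _ _ _ _ _,
    fderiv_const_mul (hdiff.differentiableAt)] at hF3
  -- compare the scalars
  have hphase := thetaTransformPhase_symplEmbed_div (γ := γ) hB h00 h11 hM h01' k
  rw [h11'] at hphase
  set X : ℂ := 2 * π * I * ((fun i => ((γ 1 1 : ℤ) : ℂ) * ((k i : ℂ) / M)) ⬝ᵥ fun i =>
          ((![-(γ 0 1 : ℤ) * (B 0 0 * k 0 + B 0 1 * k 1) + (γ' 0 0 : ℤ) * (γ' 0 1 : ℤ) * (B 0 0 / 2),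
              -(γ 0 1 : ℤ) * (B 1 0 * k 0 + B 1 1 * k 1) + (γ' 0 0 : ℤ) * (γ' 0 1 : ℤ) * (B 1 1 / 2)] :
            Fin 2 → ℤ) i : ℂ)) with hX
  have hX0 : cexp X ≠ 0 := Complex.exp_ne_zero _
  have key : fderiv ℂ (riemannThetaChar (fun i => ((γ 1 1 : ℤ) : ℂ) * ((k i : ℂ) / M)) 0 Ω') 0 =
      (cexp X)⁻¹ • ((Λ * (((γ 1 0 : ℤ) : ℂ) * (τ : ℂ) + ((γ 1 1 : ℤ) : ℂ)) ^ 2 *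
        cexp (π * I * thetaTransformPhase (symplEmbed B γ') (fun i => (k i : ℂ) / M) 0)) •
        fderiv ℂ (riemannThetaChar (fun i => (k i : ℂ) / M) 0
          (((M : ℂ) * (τ : ℂ)) • B.map ((↑) : ℤ → ℂ))) 0) := by
    rw [← hF3, smul_smul, inv_mul_cancel₀ hX0, one_smul]
  rw [key, smul_smul]
  congr 1
  rw [← Complex.exp_neg, show π * I * (((γ 0 1 : ℤ) : ℂ) * ((γ 1 1 : ℤ) : ℂ) *
      ((k ⬝ᵥ (B *ᵥ k) : ℤ) : ℂ) / M) = -X + π * I *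
        thetaTransformPhase (symplEmbed B γ') (fun i => (k i : ℂ) / M) 0 by
    rw [← hphase, hX]; ring, Complex.exp_add]
  ring

end Summit.BirchSwinnertonDyer.BirchSwinnertonDyer.Theorems.HeckeTheta

end
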